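import Summits.KontsevichZagierPeriods.Zeta5Search.RVFlatGaugeLargeParam
import Summits.KontsevichZagierPeriods.Zeta5Search.RVFlatGaugeZoneCPath
import HarnessLib.Audit
import HarnessLib

/-!
# RVFlatGaugeZoneC — ZONE C of the flat `S₇`-gauge law (two long blocks, `b₀ < 3p`): the two-long class law and the
PROVED reduction FLAT-C ⇐ it (fam-rv gen 11, file 2)

HONEST FRAMING: systematic search; no irrationality claim unless certified.  `p`-adic valuations of rational numbers; nothing about
γ, measures or irrationality.  Two statements minted by this cell appear: the NEW node `TwoLongClassLaw` (OBSERVED, stated as a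
named `Prop`, never assumed silently) and `FlatGaugeLawZoneC` (OBSERVED); the theorems are the budget inequality (unconditional), the
edge `TwoLongClassLaw → FlatGaugeLawZoneC`, and the edge from the EXISTING node `CasoratianValuationLaw` on the sub-zone `Γ ≤ 0`.

THE SETTING (`families/rv/FAMILY.md` §18.4, §21).  ZONE C = {`b` in the polytope, `p ≥ 5` prime, `b₀ < 3p`, EXACTLY two long
blocks `b₀ − 2b_{i₁} ≥ p`, `b₀ − 2b_{i₂} ≥ p`}.  On the record ray `n·(41;17,…,11)` it is the prime window `(15n, 17n]`, the slice
just above frontier (F1) = {≤ one long block, `b₀ < 3p`} where gen 10 PROVED the flat law (`flatGaugeLawF1_holds`).  In zone C the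
existing class law (CV) (`CasoratianValuation.CasoratianValuationLaw`, bonus-free) is BELOW the flat gauge on part of the zone, so
FLAT-C does not follow from (CV); the gap is an explicit ONE-DIGIT TYPE LAW found by the gen-11 census:

  `Γ(c) := pathMax(f, labels; i₁, i₂) + max(⌊d/p⌋ − 1, 0) − e_D♭(c,p)`      (`zcGamma`; `pathMax` = file 1),

where, for the labelled vector `c` (long slots `i₁, i₂` with `c_{i₁} ≤ c_{i₂}`), short slot `k` carries the label
`3·[c_k ≥ p] + level`, `level = [c₀−c_{i₁}−c_k ≥ p] + [c₀−c_{i₂}−c_k ≥ p]` (`labC`), and `f = ⌊(c₀−c_{i₁}−c_{i₂})/p⌋ ∈ {1,2}` (`fLL`).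
THEOREM (this file, `gauge_le_cv_zcGamma`, unconditional): on zone C the flat gauge bound satisfies
  `−e_D♭(c) − v_p ρ(c) ≤ (min(1,⌊d/p⌋) − N_p(c)) + Γ(c)`,
because `v_p ρ(c) = E-floors − den-floors − ⌊d/p⌋` (gen 8, Legendre below `p²`; here `d < 4p ≤ p²`), `N_p = E-floors + non-E floors`
(gen 7), and — the zone-C content — every non-`E` floor is AT MOST the abstract edge weight of file 1 and every denominator floor at most
the big indicator (`pf_le_edgeW`, `den_le_bigAt`: long–short forms are `< 2p` and `≥ p` iff the level says so, short–short forms are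
`< p`, long parameters are `< p`, short ones `< 2p`), so `nonESum + denSum ≤ pathVal ≤ pathMax`.
The census (`pub-zeta5-fam-rv/gen11/census_zoneC*.py`, exact rational arithmetic; EVERY zone-C instance `(b, j, p)` for
`p ∈ {5, 7, 11, 13}` — the complete windows `p ≤ b₀ < 3p`: `2704 + 22098 + 451369 + 1444361 = 1920532` instances on
`941 + 6455 + 108033 + 324716` vectors; table of record `out/types_all.txt`) found `Γ = (flat gauge) − (class-law level)` EXACTLY on
every instance (the maximum over `σ` is attained: `0` mismatches) and `v_p(Casoratian) ≥ class-law level + max(Γ, 0)` on every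
instance (`0` violations; attained on `254` of the `307` digit types `(f, ⌊d/p⌋, n₂, n₁, n_big)` met; `Γ > 0` on `64.0 %` of the
instances, `max Γ = 4`; FLAT `0` violations; THEOREM LB `0` violations).
Hence the node below, (CV) sharpened by the bonus `max(Γ,0)` (`zcBonus`), and the PROVED reduction
  `TwoLongClassLaw → FlatGaugeLawZoneC`   (`flatGaugeLawZoneC_of_twoLongClassLaw`, via gen 9's `S₇` transport `Cap.flat_of_perm28`).
Where `Γ ≤ 0` the node is (CV) itself (`twoLong_of_CV_of_nonpos`), so FLAT-C on that sub-zone already follows from the existing node.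
-/

namespace Summit.KontsevichZagierPeriods.Zeta5Search.RVFlatGauge

open Finset
open Summit.KontsevichZagierPeriods.Zeta5Search.CasoratianValuation (casoratian shift InPolytope pairFloors refund
  CasoratianValuationLaw)
open Summit.KontsevichZagierPeriods.Zeta5Search.WedgeDictionary (dOf Epairs)
open Summit.KontsevichZagierPeriods.Zeta5Search.SymmetricGauge
open Summit.KontsevichZagierPeriods.Zeta5Search.DualSeries (InBox)
open Window Cap ZoneC

namespace ZoneC

/-! ### The type quantity `Γ` and the bonus -/

/-- **`Γ(c)` = path maximum + `max(⌊d/p⌋ − 1, 0) − e_D♭`**: the excess of the flat `S₇`-gauge bound over the class-law level on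
zone C (THEOREM `gauge_le_cv_zcGamma`: `≤`; census: `=`). -/
def zcGamma (c : ℕ → ℤ) (p i₁ i₂ : ℕ) : ℤ :=
  (pathMax (fLL c p i₁ i₂) (labC c p i₁ i₂) i₁ i₂ : ℤ) + max (dOf c / (p : ℤ) - 1) 0 - eDflat c p

/-- The zone-C bonus `max(Γ, 0)`. -/
def zcBonus (c : ℕ → ℤ) (p i₁ i₂ : ℕ) : ℤ := max (zcGamma c p i₁ i₂) 0

/-- The bonus is nonnegative. -/
theorem zcBonus_nonneg (c : ℕ → ℤ) (p i₁ i₂ : ℕ) : 0 ≤ zcBonus c p i₁ i₂ := le_max_right _ _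

end ZoneC

/-! ### The nodes -/

/-- **The two-long class law (ZONE C)** — OBSERVED (gen-11 census, `0` violations), not proved: for `b` in the polytope, an
admissible `e_j`, a prime `p ≥ 5` with `b₀ < 3p`, exactly two long blocks at slots `i₁, i₂` (oriented: `b_{i₁} ≤ b_{i₂}`),
`v_p(Casoratian_j(b)) ≥ min(1,⌊d/p⌋) − N_p(b) + max(Γ(b), 0)`.  At `Γ ≤ 0` this is (CV) (`twoLong_of_CV_of_nonpos`). -/
@[conjecture] def TwoLongClassLaw : Prop :=
  ∀ (b : ℕ → ℤ) (j p i₁ i₂ : ℕ), InPolytope b → 1 ≤ j → j ≤ 7 → InPolytope (shift b j) → p.Prime → 5 ≤ p →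
    b 0 < 3 * (p : ℤ) → i₁ < 7 → i₂ < 7 → i₁ ≠ i₂ →
    (p : ℤ) ≤ b 0 - 2 * b (i₁ + 1) → (p : ℤ) ≤ b 0 - 2 * b (i₂ + 1) → b (i₁ + 1) ≤ b (i₂ + 1) →
    (∀ k ∈ ((range 7).erase i₁).erase i₂, b 0 - 2 * b (k + 1) < p) → casoratian b j ≠ 0 →
    refund b p - pairFloors b p + zcBonus b p i₁ i₂ ≤ padicValRat p (casoratian b j)

/-- **The flat `S₇`-gauge law on ZONE C** — two long blocks at `i₁ ≠ i₂`, all other blocks short, `b₀ < 3p`, every relabelling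
`σ`.  OBSERVED; by `flatGaugeLawZoneC_of_twoLongClassLaw` it is implied by `TwoLongClassLaw`. -/
@[conjecture] def FlatGaugeLawZoneC : Prop :=
  ∀ (b : ℕ → ℤ) (j p i₁ i₂ : ℕ) (σ : Equiv.Perm (Fin 7)), InPolytope b → 1 ≤ j → j ≤ 7 → InPolytope (shift b j) →
    p.Prime → 5 ≤ p → b 0 < 3 * (p : ℤ) → i₁ < 7 → i₂ < 7 → i₁ ≠ i₂ →
    (p : ℤ) ≤ b 0 - 2 * b (i₁ + 1) → (p : ℤ) ≤ b 0 - 2 * b (i₂ + 1) →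
    (∀ k ∈ ((range 7).erase i₁).erase i₂, b 0 - 2 * b (k + 1) < p) → casoratian b j ≠ 0 →
    -eDflat b p - padicValRat p (rhoB (permLower σ b)) ≤ padicValRat p (casoratian b j)

namespace ZoneC

/-! ### The termwise bounds -/

/-- **Every non-`E` floor is at most the abstract edge weight** (zone C, oriented long slots `i₁, i₂`). -/
theorem pf_le_edgeW (c : ℕ → ℤ) {p : ℕ} (hc : InPolytope c) (hp0 : (0 : ℤ) < p) (hc3 : c 0 < 3 * (p : ℤ))
    {i₁ i₂ : ℕ} (hi₁ : i₁ < 7) (hi₂ : i₂ < 7) (hle : c (i₁ + 1) ≤ c (i₂ + 1))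
    (hsh : ∀ k, k < 7 → k ≠ i₁ → k ≠ i₂ → c 0 - 2 * c (k + 1) < (p : ℤ))
    (x : ℕ × ℕ) (hx1 : x.1 < 7) (hx2 : x.2 < 7) (hx : x.1 ≠ x.2) :
    pf c p x ≤ (edgeW i₁ i₂ (fLL c p i₁ i₂) (labC c p i₁ i₂) x : ℤ) := by
  obtain ⟨⟨-, hbox⟩, hhalf, -⟩ := id hc
  have hnn : ∀ k, k < 7 → 0 ≤ c (k + 1) ∧ 2 * c (k + 1) ≤ c 0 := fun k hk =>
    ⟨(hbox k (mem_range.2 hk)).1, hhalf k (mem_range.2 hk)⟩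
  obtain ⟨h1n, h1h⟩ := hnn x.1 hx1
  obtain ⟨h2n, h2h⟩ := hnn x.2 hx2
  obtain ⟨hi1n, hi1h⟩ := hnn i₁ hi₁
  obtain ⟨hi2n, hi2h⟩ := hnn i₂ hi₂
  -- the long–short value as an indicator, for a long slot `i ∈ {i₁, i₂}` and a short slot `k`
  have hLS : ∀ i k, i < 7 → k < 7 → k ≠ i₁ → k ≠ i₂ → (c 0 - c (i + 1) - c (k + 1)) / (p : ℤ) =
      if (p : ℤ) ≤ c 0 - c (i + 1) - c (k + 1) then 1 else 0 := fun i k hi hk hk1 hk2 =>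
    pf_long_short c hp0 hc3 (hnn i hi).1 (hnn k hk).2 (hnn i hi).2 (hsh k hk hk1 hk2)
  have hsymm : ∀ a b : ℕ, c 0 - c (a + 1) - c (b + 1) = c 0 - c (b + 1) - c (a + 1) := fun a b => by ring
  unfold pf edgeW
  by_cases hA : (x.1 = i₁ ∧ x.2 = i₂) ∨ (x.1 = i₂ ∧ x.2 = i₁)
  · rw [if_pos hA]
    rcases hA with ⟨ha, hb⟩ | ⟨ha, hb⟩
    · rw [ha, hb]; exact pf_le_fLL c hp0 hc3 hi1n hi2n
    · rw [ha, hb, hsymm]; exact pf_le_fLL c hp0 hc3 hi1n hi2n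
  rw [if_neg hA]
  by_cases hB : x.1 = i₁
  · -- `x.2` is short
    have hk1 : x.2 ≠ i₁ := fun h => hx (hB.trans h.symm)
    have hk2 : x.2 ≠ i₂ := fun h => hA (Or.inl ⟨hB, h⟩)
    rw [if_pos hB, labC_mod_three c p (show ¬ (x.2 = i₁ ∨ x.2 = i₂) by tauto), hB, hLS i₁ x.2 hi₁ hx2 hk1 hk2]
    by_cases hl : lam c p i₁ x.2 = true
    · have hl' : (p : ℤ) ≤ c 0 - c (i₁ + 1) - c (x.2 + 1) := by simpa [lam] using hl
      rw [if_pos hl', if_pos hl]; split_ifs <;> omega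
    · have hl' : ¬ (p : ℤ) ≤ c 0 - c (i₁ + 1) - c (x.2 + 1) := by simpa [lam] using hl
      rw [if_neg hl', if_neg hl]; simp
  rw [if_neg hB]
  by_cases hC : x.2 = i₁
  · -- `x.1` is short
    have hk2 : x.1 ≠ i₂ := fun h => hA (Or.inr ⟨h, hC⟩)
    rw [if_pos hC, labC_mod_three c p (show ¬ (x.1 = i₁ ∨ x.1 = i₂) by tauto), hC, hsymm,
      hLS i₁ x.1 hi₁ hx1 hB hk2]
    by_cases hl : lam c p i₁ x.1 = true
    · have hl' : (p : ℤ) ≤ c 0 - c (i₁ + 1) - c (x.1 + 1) := by simpa [lam] using hl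
      rw [if_pos hl', if_pos hl]; split_ifs <;> omega
    · have hl' : ¬ (p : ℤ) ≤ c 0 - c (i₁ + 1) - c (x.1 + 1) := by simpa [lam] using hl
      rw [if_neg hl', if_neg hl]; simp
  rw [if_neg hC]
  by_cases hD : x.1 = i₂
  · -- `x.2` is short; a level with `i₂` forces level `2`
    have hk2 : x.2 ≠ i₂ := fun h => hx (hD.trans h.symm)
    rw [if_pos hD, labC_mod_three c p (show ¬ (x.2 = i₁ ∨ x.2 = i₂) by tauto), hD, hLS i₂ x.2 hi₂ hx2 hC hk2]
    by_cases hl : lam c p i₂ x.2 = true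
    · have hl' : (p : ℤ) ≤ c 0 - c (i₂ + 1) - c (x.2 + 1) := by simpa [lam] using hl
      rw [if_pos hl', if_pos (lam_of_lam c p hle hl), if_pos hl]; simp
    · have hl' : ¬ (p : ℤ) ≤ c 0 - c (i₂ + 1) - c (x.2 + 1) := by simpa [lam] using hl
      rw [if_neg hl']; split_ifs <;> simp
  rw [if_neg hD]
  by_cases hE : x.2 = i₂
  · -- `x.1` is short
    rw [if_pos hE, labC_mod_three c p (show ¬ (x.1 = i₁ ∨ x.1 = i₂) by tauto), hE, hsymm,
      hLS i₂ x.1 hi₂ hx1 hB hD]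
    by_cases hl : lam c p i₂ x.1 = true
    · have hl' : (p : ℤ) ≤ c 0 - c (i₂ + 1) - c (x.1 + 1) := by simpa [lam] using hl
      rw [if_pos hl', if_pos (lam_of_lam c p hle hl), if_pos hl]; simp
    · have hl' : ¬ (p : ℤ) ≤ c 0 - c (i₂ + 1) - c (x.1 + 1) := by simpa [lam] using hl
      rw [if_neg hl']; split_ifs <;> simp
  rw [if_neg hE]
  -- both endpoints short
  rw [pf_short_short c h1h h2h (hsh x.1 hx1 hB hD) (hsh x.2 hx2 hC hE)]; simp

/-- **Every denominator floor is at most the big indicator** (long parameters are `< p`, short ones `< 3p/2`). -/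
theorem den_le_bigAt (c : ℕ → ℤ) {p : ℕ} (hc : InPolytope c) (hp0 : (0 : ℤ) < p) (hc3 : c 0 < 3 * (p : ℤ))
    {i₁ i₂ : ℕ} (hL₁ : (p : ℤ) ≤ c 0 - 2 * c (i₁ + 1)) (hL₂ : (p : ℤ) ≤ c 0 - 2 * c (i₂ + 1)) (k : ℕ) (hk : k < 7) :
    c (k + 1) / (p : ℤ) ≤ (bigAt (labC c p i₁ i₂) k : ℤ) := by
  obtain ⟨⟨-, hbox⟩, hhalf, -⟩ := id hc
  have hk0 : 0 ≤ c (k + 1) := (hbox k (mem_range.2 hk)).1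
  have hk2 : 2 * c (k + 1) ≤ c 0 := hhalf k (mem_range.2 hk)
  have hq1 : c (k + 1) / (p : ℤ) ≤ 1 := by
    have := (Int.ediv_lt_iff_lt_mul hp0).2 (show c (k + 1) < 2 * (p : ℤ) by linarith); omega
  unfold bigAt
  by_cases hkl : k = i₁ ∨ k = i₂
  · -- a long slot: `c_k < p`
    have hlt : c (k + 1) < (p : ℤ) := by rcases hkl with rfl | rfl <;> linarith
    rw [Int.ediv_eq_zero_of_lt hk0 hlt]; positivity
  · rw [labC_div_three c p hkl]
    by_cases hb : bigB c p k = true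
    · rw [if_pos hb]; simp only [le_refl, if_true, Nat.cast_one]; exact hq1
    · have hb' : ¬ (p : ℤ) ≤ c (k + 1) := by simpa [bigB] using hb
      rw [if_neg hb, Int.ediv_eq_zero_of_lt hk0 (by linarith)]; simp

/-! ### The budget inequality -/

/-- **THEOREM (zone-C budget, unconditional).**  On an oriented zone-C vector the flat `S₇`-gauge bound is at most the class-law
level plus `Γ`:  `−e_D♭(c) − v_p ρ(c) ≤ min(1,⌊d/p⌋) − N_p(c) + Γ(c)`. -/
theorem gauge_le_cv_zcGamma (c : ℕ → ℤ) {p : ℕ} (hc : InPolytope c) (hp : p.Prime) (hp5 : 5 ≤ p)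
    (hc3 : c 0 < 3 * (p : ℤ)) {i₁ i₂ : ℕ} (hi₁ : i₁ < 7) (hi₂ : i₂ < 7) (hne : i₁ ≠ i₂)
    (hL₁ : (p : ℤ) ≤ c 0 - 2 * c (i₁ + 1)) (hL₂ : (p : ℤ) ≤ c 0 - 2 * c (i₂ + 1)) (hle : c (i₁ + 1) ≤ c (i₂ + 1))
    (hshort : ∀ k ∈ ((range 7).erase i₁).erase i₂, c 0 - 2 * c (k + 1) < p) :
    -eDflat c p - padicValRat p (rhoB c) ≤ refund c p - pairFloors c p + zcGamma c p i₁ i₂ := by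
  have hp0 : (0 : ℤ) < p := by exact_mod_cast hp.pos
  have hp2 : p ≠ 2 := by have := hp.two_le; omega
  have hp5' : (5 : ℤ) ≤ p := by exact_mod_cast hp5
  obtain ⟨⟨h00, hbox⟩, hhalf, hsum⟩ := id hc
  have hnn : ∀ k, k < 7 → 0 ≤ c (k + 1) ∧ 2 * c (k + 1) ≤ c 0 := fun k hk =>
    ⟨(hbox k (mem_range.2 hk)).1, hhalf k (mem_range.2 hk)⟩
  have hsh : ∀ k, k < 7 → k ≠ i₁ → k ≠ i₂ → c 0 - 2 * c (k + 1) < (p : ℤ) := fun k hk h1 h2 =>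
    hshort k (mem_erase.2 ⟨h2, mem_erase.2 ⟨h1, mem_range.2 hk⟩⟩)
  -- `0 ≤ d < 4p ≤ p²`
  have hd0 : 0 ≤ dOf c := by unfold dOf; linarith
  have hd4 : dOf c < 4 * (p : ℤ) := by
    have hmem₂ : i₂ ∈ (range 7).erase i₁ := mem_erase.2 ⟨hne.symm, mem_range.2 hi₂⟩
    have h5 : ∑ k ∈ ((range 7).erase i₁).erase i₂, (c 0 - 2 * c (k + 1)) ≤ 5 * ((p : ℤ) - 1) := by
      have h := Finset.sum_le_card_nsmul (((range 7).erase i₁).erase i₂) (fun k => c 0 - 2 * c (k + 1)) ((p : ℤ) - 1)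
        (fun k hk => by
          have := hshort k hk
          show c 0 - 2 * c (k + 1) ≤ (p : ℤ) - 1
          omega)
      rw [card_erase_of_mem hmem₂, card_erase_of_mem (mem_range.2 hi₁), card_range] at h
      simpa [nsmul_eq_mul] using h
    have hs₂ := Finset.sum_erase_eq_sub (f := fun k => c 0 - 2 * c (k + 1)) hmem₂
    have hs₁ := Finset.sum_erase_eq_sub (f := fun k => c 0 - 2 * c (k + 1)) (mem_range.2 hi₁)
    have hall : ∑ k ∈ range 7, (c 0 - 2 * c (k + 1)) = 7 * c 0 - 2 * ∑ k ∈ range 7, c (k + 1) := by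
      rw [Finset.sum_sub_distrib, Finset.sum_const, card_range, ← Finset.mul_sum]
      simp
    rw [hs₂, hs₁, hall] at h5
    have := (hnn i₁ hi₁).1
    have := (hnn i₂ hi₂).1
    unfold dOf
    linarith
  have hdp : dOf c < (p : ℤ) ^ 2 := by nlinarith
  -- the closed forms of `v_p ρ`, `N_p`, the refund
  have hval := padicValRat_rhoB_midParams hc hp hp2 (win_of_lt_three_p hp5 hc3) hdp
  have hpf := pairFloors_eq_eSum_add c p
  have hrefund : refund c p = min 1 (dOf c / (p : ℤ)) := rfl
  have hdig : min 1 (dOf c / (p : ℤ)) + max (dOf c / (p : ℤ) - 1) 0 = dOf c / (p : ℤ) := by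
    rcases le_or_gt 1 (dOf c / (p : ℤ)) with h | h
    · rw [min_eq_left h, max_eq_left (by linarith)]; ring
    · rw [min_eq_right h.le, max_eq_right (by linarith)]; ring
  -- the combinatorial heart: `nonESum + denSum ≤ pathVal ≤ pathMax`
  have hnonE : nonESum c p = pf c p (0, 5) + pf c p (0, 6) + pf c p (1, 6) + pf c p (2, 4) + pf c p (3, 4) + pf c p (3, 5) := by
    simp [nonESum, nonE, Finset.sum_insert, add_assoc]
  have hdexp : denSum c p = c 1 / p + c 4 / p + c 5 / p + c 6 / p + c 7 / p := by
    simp only [denSum, List.map_cons, List.map_nil, List.sum_cons, List.sum_nil]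
    ring
  have hE := pf_le_edgeW c hc hp0 hc3 hi₁ hi₂ hle hsh
  have hD := den_le_bigAt c hc hp0 hc3 hL₁ hL₂ (i₁ := i₁) (i₂ := i₂)
  have hmain : nonESum c p + denSum c p ≤ (pathVal i₁ i₂ (fLL c p i₁ i₂) (labC c p i₁ i₂) : ℤ) := by
    have e05 := hE (0, 5) (by norm_num) (by norm_num) (by norm_num)
    have e06 := hE (0, 6) (by norm_num) (by norm_num) (by norm_num)
    have e16 := hE (1, 6) (by norm_num) (by norm_num) (by norm_num)
    have e24 := hE (2, 4) (by norm_num) (by norm_num) (by norm_num)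
    have e34 := hE (3, 4) (by norm_num) (by norm_num) (by norm_num)
    have e35 := hE (3, 5) (by norm_num) (by norm_num) (by norm_num)
    have d0 := hD 0 (by norm_num)
    have d3 := hD 3 (by norm_num)
    have d4 := hD 4 (by norm_num)
    have d5 := hD 5 (by norm_num)
    have d6 := hD 6 (by norm_num)
    simp only [Nat.reduceAdd] at d0 d3 d4 d5 d6
    rw [hnonE, hdexp]
    unfold pathVal
    push_cast
    linarith
  have hmax : (pathVal i₁ i₂ (fLL c p i₁ i₂) (labC c p i₁ i₂) : ℤ) ≤ pathMax (fLL c p i₁ i₂) (labC c p i₁ i₂) i₁ i₂ := by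
    exact_mod_cast pathVal_le_pathMax (fLL c p i₁ i₂) (labC c p i₁ i₂) i₁ i₂
  unfold zcGamma
  rw [hval, hrefund, hpf]
  linarith

/-! ### Transport along `σ` and the reduction -/

/-- Zone-C hypotheses are `S₇`-invariant: the relabelled vector has its two long blocks at the preimages of `i₁, i₂`. -/
theorem zoneC_permLower (σ : Equiv.Perm (Fin 7)) {b : ℕ → ℤ} {p : ℕ} {i₁ i₂ : ℕ} (hi₁ : i₁ < 7) (hi₂ : i₂ < 7)
    (hne : i₁ ≠ i₂) (hL₁ : (p : ℤ) ≤ b 0 - 2 * b (i₁ + 1)) (hL₂ : (p : ℤ) ≤ b 0 - 2 * b (i₂ + 1))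
    (hshort : ∀ k ∈ ((range 7).erase i₁).erase i₂, b 0 - 2 * b (k + 1) < (p : ℤ)) :
    ∃ i₁' i₂' : ℕ, i₁' < 7 ∧ i₂' < 7 ∧ i₁' ≠ i₂' ∧ permLower σ b (i₁' + 1) = b (i₁ + 1) ∧
      permLower σ b (i₂' + 1) = b (i₂ + 1) ∧
      (p : ℤ) ≤ permLower σ b 0 - 2 * permLower σ b (i₁' + 1) ∧ (p : ℤ) ≤ permLower σ b 0 - 2 * permLower σ b (i₂' + 1) ∧
      ∀ k ∈ ((range 7).erase i₁').erase i₂', permLower σ b 0 - 2 * permLower σ b (k + 1) < (p : ℤ) := by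
  set a₁ : Fin 7 := σ.symm ⟨i₁, hi₁⟩ with ha₁
  set a₂ : Fin 7 := σ.symm ⟨i₂, hi₂⟩ with ha₂
  have hσ₁ : σ a₁ = ⟨i₁, hi₁⟩ := by rw [ha₁, Equiv.apply_symm_apply]
  have hσ₂ : σ a₂ = ⟨i₂, hi₂⟩ := by rw [ha₂, Equiv.apply_symm_apply]
  have he₁ : permLower σ b (a₁.val + 1) = b (i₁ + 1) := by rw [permLower_apply_succ, hσ₁]
  have he₂ : permLower σ b (a₂.val + 1) = b (i₂ + 1) := by rw [permLower_apply_succ, hσ₂]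
  have hne' : a₁.val ≠ a₂.val := by
    intro h
    have ha : a₁ = a₂ := Fin.ext h
    have : (⟨i₁, hi₁⟩ : Fin 7) = ⟨i₂, hi₂⟩ := by rw [← hσ₁, ← hσ₂, ha]
    exact hne (congrArg Fin.val this)
  refine ⟨a₁.val, a₂.val, a₁.isLt, a₂.isLt, hne', he₁, he₂, ?_, ?_, fun k hk => ?_⟩
  · rw [permLower_zero, he₁]; exact hL₁
  · rw [permLower_zero, he₂]; exact hL₂
  · obtain ⟨hk2, hk⟩ := mem_erase.1 hk
    obtain ⟨hk1, hk7⟩ := mem_erase.1 hk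
    have hk7 := mem_range.1 hk7
    have happ := permLower_apply_succ σ b ⟨k, hk7⟩
    simp only at happ
    rw [permLower_zero, happ]
    refine hshort _ (mem_erase.2 ⟨fun h => hk2 ?_, mem_erase.2 ⟨fun h => hk1 ?_, mem_range.2 (σ ⟨k, hk7⟩).isLt⟩⟩)
    · have hσk : σ ⟨k, hk7⟩ = ⟨i₂, hi₂⟩ := Fin.ext h
      have := congrArg σ.symm hσk
      rw [Equiv.symm_apply_apply] at this
      rw [ha₂]; exact congrArg Fin.val this
    · have hσk : σ ⟨k, hk7⟩ = ⟨i₁, hi₁⟩ := Fin.ext h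
      have := congrArg σ.symm hσk
      rw [Equiv.symm_apply_apply] at this
      rw [ha₁]; exact congrArg Fin.val this

/-- Swapping the roles of the two long slots in the short-block hypothesis. -/
theorem short_swap {b : ℕ → ℤ} {p : ℕ} {i₁ i₂ : ℕ}
    (hshort : ∀ k ∈ ((range 7).erase i₁).erase i₂, b 0 - 2 * b (k + 1) < (p : ℤ)) :
    ∀ k ∈ ((range 7).erase i₂).erase i₁, b 0 - 2 * b (k + 1) < (p : ℤ) := fun k hk => by
  simp only [mem_erase] at hk
  exact hshort k (mem_erase.2 ⟨hk.2.1, mem_erase.2 ⟨hk.1, hk.2.2⟩⟩)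

end ZoneC

/-- **THEOREM (the reduction, PROVED): `TwoLongClassLaw → FlatGaugeLawZoneC`.**  The two-long class law at the relabelled vector
`σ·b` (oriented there), composed with the budget inequality and gen 9's `S₇` transport `Cap.flat_of_perm28`. -/
theorem flatGaugeLawZoneC_of_twoLongClassLaw (h : TwoLongClassLaw) : FlatGaugeLawZoneC := by
  intro b j p i₁ i₂ σ hb hj1 hj7 hb' hp hp5 hb3 hi₁ hi₂ hne hL₁ hL₂ hshort hcas
  obtain ⟨i₁', i₂', hi₁', hi₂', hne', -, -, hL₁', hL₂', hshort'⟩ := ZoneC.zoneC_permLower σ hi₁ hi₂ hne hL₁ hL₂ hshort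
  have hb3' : permLower σ b 0 < 3 * (p : ℤ) := by rw [permLower_zero]; exact hb3
  have hcb := inPolytope_permLower σ hb
  refine flat_of_perm28 b σ hj1 hj7 hb' hcas fun j' hj1' hj7' hshift hne0 => ?_
  rcases le_total (permLower σ b (i₁' + 1)) (permLower σ b (i₂' + 1)) with hle | hle
  · have h1 := ZoneC.gauge_le_cv_zcGamma (permLower σ b) hcb hp hp5 hb3' hi₁' hi₂' hne' hL₁' hL₂' hle hshort'
    have h2 := h (permLower σ b) j' p i₁' i₂' hcb hj1' hj7' hshift hp hp5 hb3' hi₁' hi₂' hne' hL₁' hL₂' hle hshort' hne0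
    have h3 : ZoneC.zcGamma (permLower σ b) p i₁' i₂' ≤ ZoneC.zcBonus (permLower σ b) p i₁' i₂' := le_max_left _ _
    linarith
  · have hshort'' := ZoneC.short_swap hshort'
    have h1 := ZoneC.gauge_le_cv_zcGamma (permLower σ b) hcb hp hp5 hb3' hi₂' hi₁' hne'.symm hL₂' hL₁' hle hshort''
    have h2 := h (permLower σ b) j' p i₂' i₁' hcb hj1' hj7' hshift hp hp5 hb3' hi₂' hi₁' hne'.symm hL₂' hL₁' hle
      hshort'' hne0
    have h3 : ZoneC.zcGamma (permLower σ b) p i₂' i₁' ≤ ZoneC.zcBonus (permLower σ b) p i₂' i₁' := le_max_left _ _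
    linarith

/-- The trivial edge from the conjecture node: `FlatGaugeLaw → FlatGaugeLawZoneC` (`m₁ ≤ b₀ + 1 < p²` since `b₀ < 3p`) —
consistency of the nodes. -/
theorem flatGaugeLawZoneC_of_flatGaugeLaw (h : FlatGaugeLaw) : FlatGaugeLawZoneC := by
  intro b j p i₁ i₂ σ hb hj1 hj7 hb' hp hp5 hb3 _ _ _ _ _ _ hcas
  have hwin := win_of_lt_three_p hp5 hb3
  exact h b j p σ hb hj1 hj7 hb' hp hp5 (by have := Window.m1_le_b0_add_one hb; linarith) hcas

/-- **The edge from the EXISTING node (CV)**: where `Γ ≤ 0` the two-long class law is `CasoratianValuationLaw` itself (the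
bonus vanishes; `b₀ < 3p` gives the window `b₀ + 2 < p²`). -/
theorem twoLong_of_CV_of_nonpos (hCV : CasoratianValuationLaw) (b : ℕ → ℤ) {j p i₁ i₂ : ℕ} (hb : InPolytope b)
    (hj1 : 1 ≤ j) (hj7 : j ≤ 7) (hb' : InPolytope (shift b j)) (hp : p.Prime) (hp5 : 5 ≤ p) (hb3 : b 0 < 3 * (p : ℤ))
    (hγ : ZoneC.zcGamma b p i₁ i₂ ≤ 0) (hcas : casoratian b j ≠ 0) :
    refund b p - pairFloors b p + ZoneC.zcBonus b p i₁ i₂ ≤ padicValRat p (casoratian b j) := by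
  have h0 : ZoneC.zcBonus b p i₁ i₂ = 0 := by unfold ZoneC.zcBonus; exact max_eq_right hγ
  rw [h0, add_zero]
  exact hCV b j p hb hj1 hj7 hb' hp hp5 (win_of_lt_three_p hp5 hb3) hcas

/-- Conversely the two-long class law contains (CV) on zone C (the bonus is nonnegative) — consistency of the nodes. -/
theorem cv_of_twoLong (h : TwoLongClassLaw) (b : ℕ → ℤ) {j p i₁ i₂ : ℕ} (hb : InPolytope b) (hj1 : 1 ≤ j) (hj7 : j ≤ 7)
    (hb' : InPolytope (shift b j)) (hp : p.Prime) (hp5 : 5 ≤ p) (hb3 : b 0 < 3 * (p : ℤ)) (hi₁ : i₁ < 7) (hi₂ : i₂ < 7)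
    (hne : i₁ ≠ i₂) (hL₁ : (p : ℤ) ≤ b 0 - 2 * b (i₁ + 1)) (hL₂ : (p : ℤ) ≤ b 0 - 2 * b (i₂ + 1))
    (hle : b (i₁ + 1) ≤ b (i₂ + 1)) (hshort : ∀ k ∈ ((range 7).erase i₁).erase i₂, b 0 - 2 * b (k + 1) < p)
    (hcas : casoratian b j ≠ 0) : refund b p - pairFloors b p ≤ padicValRat p (casoratian b j) := by
  have := h b j p i₁ i₂ hb hj1 hj7 hb' hp hp5 hb3 hi₁ hi₂ hne hL₁ hL₂ hle hshort hcas
  have h0 := ZoneC.zcBonus_nonneg b p i₁ i₂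
  linarith

/-! ### Kernel instances (census examples; the bonus is computable) -/

/-- `b = (10;5,5,5,5,5,0,0)`: zone C at `p = 5` (`b₀ = 10 < 15`; long slots `5, 6`; five big level-2 shorts; `⌊d/p⌋ = 1`):
excess `Γ = 2`. -/
def bC1 : ℕ → ℤ := fun i => (([10, 5, 5, 5, 5, 5, 0, 0] : List ℤ).getD i 0)

/-- `b = (14;7,5,5,5,5,0,0)`: zone C at `p = 5` (long slots `5, 6`; five big level-2 shorts; `⌊d/p⌋ = 3`): excess `Γ = 4`, the
LARGEST value in the census (and attained: `v_5(Casoratian_2) = −7 =` flat gauge `=` class-law level `−11 + 4` there — census row,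
not claimed here). -/
def bC2 : ℕ → ℤ := fun i => (([14, 7, 5, 5, 5, 5, 0, 0] : List ℤ).getD i 0)

set_option maxRecDepth 200000 in
/-- The path maxima of the two census examples (kernel): both label patterns are `[5,5,5,5,5,0,0]` with `f = 2`, value `7` (the
absolute ceiling `zcM 2 5 4 5`). -/
theorem pathMax_examples : pathMax (ZoneC.fLL bC1 5 5 6) (ZoneC.labC bC1 5 5 6) 5 6 = 7 ∧
    pathMax (ZoneC.fLL bC2 5 5 6) (ZoneC.labC bC2 5 5 6) 5 6 = 7 := by
  refine ⟨?_, ?_⟩ <;> decide +kernel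

/-- The remaining digits: `e_D♭ = 5`, `⌊d/p⌋ = 1` at `bC1`; `e_D♭ = 5`, `⌊d/p⌋ = 3` at `bC2` — hence the census values
`Γ(bC1, 5) = 7 + 0 − 5 = 2` and `Γ(bC2, 5) = 7 + 2 − 5 = 4` (each equals flat gauge − class-law level, `−9 − (−11)` resp.
`−7 − (−11)`, in the census; census rows, not claimed here). -/
theorem digit_examples : eDflat bC1 5 = 5 ∧ dOf bC1 / (5 : ℤ) = 1 ∧ eDflat bC2 5 = 5 ∧ dOf bC2 / (5 : ℤ) = 3 := by
  decide

end Summit.KontsevichZagierPeriods.Zeta5Search.RVFlatGauge
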